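import Literature.Geometry.Lorentzian.PositiveMassRicciVariation
import Literature.Geometry.Lorentzian.MetricNormSq
import Literature.Geometry.Lorentzian.Volume
import HarnessLib

/-!
# The Ricci variation of Schoen–Yau, II: the scalar curvature function of a family of data

Schoen–Yau's Ricci variation (Comm. Math. Phys. 65 (1979), §3, pp. 72–74) works with the
one-parameter family `ds²_t = ds² + t Ric` and its scalar curvature `R_t` ((3.24)–(3.30)). For
families of data `t ↦ D_t` the standing instance hypothesis `[D.metric.HasLeviCivita]` of the
curvature API is not available as a binder, so this file packages the scalar curvature of the
metric of `D` with the canonical instance every smooth metric has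
(`PseudoRiemannianMetric.hasLeviCivita`):

* `InitialDataSet.scalarCurvatureFn` — `R(h) : X → ℝ`, with `scalarCurvatureFn_eq` (it is the
  API's `scalarCurvature` under any instance) and `scalarCurvatureFn_congr` (**the scalar
  curvature depends only on the values of the metric**), via
  `PseudoRiemannianMetric.scalarCurvature_congr_metric`.

These are the objects in which the analytic steps of the printed proof are stated — Lemma 3.3
applied to the family and the differentiation of the mass integral (3.27)–(3.30) — in the
reduction of step 2 of positive mass rigidity, `exists_ricciVariation_negativeMass_of_massZero`,
to those two steps (`exists_ricciVariation_negativeMass_of_massZero_of_elliptic_steps`,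
`RicciVariationEllipticSteps.lean`), and in the first variation `R'₀ = -‖Ric‖²`
(`hasDerivAt_scalarCurvatureFn_ricciVariation`, `RicciVariationScalarCurvature.lean`).
(History: this file first proved an intermediate named fact — the mass function (3.26)–(3.30)
packaged as a `Prop` — from six printed steps; that fact was merged back into its parent under the
decomposition discipline D-0026 and the reduction now lives, with four of the six steps proved, in
`RicciVariationEllipticSteps.lean`.)

## References

* R. Schoen, S.-T. Yau, *On the proof of the positive mass conjecture in general relativity*,
  Comm. Math. Phys. 65 (1979) 45–76, §3, pp. 72–74, (3.24)–(3.30).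
* B. O'Neill, *Semi-Riemannian geometry*, Academic Press 1983, Ch. 3, Def. 3.53.
-/

noncomputable section

open Bundle Set Manifold TopologicalSpace Filter Asymptotics Module MeasureTheory
open scoped ContDiff Topology Manifold

namespace Literature.Geometry.Lorentzian

/-! ### The scalar curvature function of data, with the canonical Levi-Civita instance -/

namespace InitialDataSet

variable {X : Type} [TopologicalSpace X] [ChartedSpace E3 X] [IsManifold (𝓡 3) ∞ X]

/-- The **scalar curvature function** `R(h) : X → ℝ` of the metric of the data `D`, the standing
Levi-Civita hypothesis `[D.metric.HasLeviCivita]` of the curvature API being supplied by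
`PseudoRiemannianMetric.hasLeviCivita` (`LeviCivitaProofs.lean`: every smooth metric has its
Levi-Civita connection). Used for families of data `t ↦ D_t`, where instance binders are
unavailable; agrees with `D.metric.scalarCurvature` (`scalarCurvatureFn_eq`). O'Neill 1983,
Ch. 3, Def. 3.53. [cite: ONeill1983, Ch. 3, Def. 3.53] -/
def scalarCurvatureFn (D : InitialDataSet (𝓡 3) X) (x : X) : ℝ :=
  haveI := D.metric.hasLeviCivita
  D.metric.scalarCurvature x

/-- `scalarCurvatureFn` is the scalar curvature of the curvature API, whatever instance of the
(propositional) Levi-Civita hypothesis is in scope. [folklore] -/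
theorem scalarCurvatureFn_eq (D : InitialDataSet (𝓡 3) X) [D.metric.HasLeviCivita] (x : X) :
    D.scalarCurvatureFn x = D.metric.scalarCurvature x := rfl

/-- The scalar curvature of a smooth metric, for two instances of its Levi-Civita hypothesis and
two syntactic copies of the metric, agree. [folklore] -/
theorem _root_.Literature.Geometry.Lorentzian.PseudoRiemannianMetric.scalarCurvature_congr_metric
    {g₁ g₂ : PseudoRiemannianMetric (𝓡 3) ∞ E3 (TangentSpace (𝓡 3) : X → Type _)}
    [g₁.HasLeviCivita] [g₂.HasLeviCivita] (hg : g₁ = g₂) (x : X) :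
    g₁.scalarCurvature x = g₂.scalarCurvature x := by
  subst hg
  rfl

/-- **The scalar curvature depends only on the values of the metric**: data with pointwise equal
metrics have equal scalar curvature functions (the metric of `InitialDataSet` is determined by
its values, `PseudoRiemannianMetric.ext`). [folklore] -/
theorem scalarCurvatureFn_congr {D₁ D₂ : InitialDataSet (𝓡 3) X}
    (h : ∀ (x : X) (v w : TangentSpace (𝓡 3) x), D₁.metric.val x v w = D₂.metric.val x v w) :
    D₁.scalarCurvatureFn = D₂.scalarCurvatureFn := by
  have hm : D₁.metric = D₂.metric :=
    PseudoRiemannianMetric.ext (funext fun x ↦ by ext v w; exact h x v w)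
  funext x
  haveI := D₁.metric.hasLeviCivita
  haveI := D₂.metric.hasLeviCivita
  exact PseudoRiemannianMetric.scalarCurvature_congr_metric hm x

end InitialDataSet

end Literature.Geometry.Lorentzian

end
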